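import Mathlib
import Summits.PneNP.PneNP.Theorems.ConvexRankGatesConvexGateBlindExactLiftingUnitLevel
import Summits.PneNP.PneNP.Theorems.ConvexRankGatesConvexGateBlindExactLiftingSosCalibration

/-!
# PneNP / ConvexRankGates — `ConvexGateBlind`, line `xor-door-perfect-completeness`:
# the TRIANGLE instance of `stub_exactLifting` — the minimal matrix family on which the stub's
# mechanism (strict non-negative rank leaving the rank corner at `ε = 0⁺`) is open (lead c5)

Registered sub-goal `triangle_window` of crux item stmt-PneNP-10680 (line
`xor-door-perfect-completeness`, open stub `stub_exactLifting : XorDoor.ExactLifting`).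

`ExactLifting` asks that the exponent of `ε ↦ rk(PSD_q ⊕ ℝ^r)-size of (viol_F(x[w]) − ε)_{x,w}` has left
the rank corner already at `ε = 0⁺`, uniformly in the fooling degree.  On the K₄ instance of record
(`…ExactLiftingK4.lean`, `…ExactLiftingUnitLevel.lean`) the LP exponent climbs from `3` (`ε = 0`) to `5`
(`ε = 1`) and nothing is known in between.  This file records the smallest matrix family with the same
shape one dimension down — three blocks instead of six — as the instance on which a construction OR a
lower bound is a print-level statement (an explicit polynomial separation of Hrubeš's strict rank
`rk₊₊` from `rk₊` is not in print: Hrubeš 2020, Open Problem 4):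

  `M_t[x,w] = 1 + 2·[x₀(w₀) = x₁(w₁) = x₂(w₂)]`   (`x : Fin 3 → Fin t → 𝔽₂`, `w : Fin 3 → Fin t`),

the violation count of the ODD TRIANGLE of 2-XOR constraints `y₀ ≠ y₁, y₁ ≠ y₂, y₂ ≠ y₀` composed with
the Index gadget (`triM`; it is the Index-lift of the word set `TriZ = {000, 111}`; as a 2-XOR system it
lies outside the 3-sparse `Pool`, so it is written directly).  Kernel-checked window (`triangle_window`,
registered, all `t ≥ 1`):

* (cheap corner) `HasConeFact (M_t) 0 (3t²)`: `M_t = Σ_{i} [y_i = y_{i+1}]`, one 0/1 rectangle per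
  (pair, pointer pair) (`coneFact_triM`);
* (unit level, both sides) `HasConeFact (M_t − J) 0 (t³)` (one rectangle per pointer triple,
  `coneFact_triM_sub_one`) and conversely every non-negative factorisation of `M_t − J` with `r` terms
  has `t³ ≤ 108·r` (`triM_unitLevel`: `TriZ` has no subcube of codimension `< 3`, `tri_noSubcube`, and
  c4's Index-lift rectangle lemma `IndexRect.indexRect_nmf_bound`);
* (the mixed cone is blind to it) for every `ε ≤ 3/4`, `HasConeFact (M_t − ε) (3t+1) 0`
  (`coneFact_triM_shift_psd`): in `±1` variables `viol = 3/4 + (s₀+s₁+s₂)²/4`, a degree-1 SOS, so the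
  PSD part sees NO jump at `ε = 0⁺`; the triangle instance isolates the LP mechanism only (for K₄ the
  PSD window is `[3/2, 4]`, lead c2).

So the LP strict rank `rk₊₊(M_t) = lim_{ε→0⁺} rk₊(M_t − εJ) ± 1` sits in `[3t² − 3t + 1, t³ + 1]`
(rank below, unit level + 1 above) and deciding its exponent is OPEN; in Hrubeš's monotone-separation
form it reads: does "transversal triangle vs. bipartite edge set of K_{t,t,t}" have a LINEAR-size
(`O(t²)` = O(#variables)) monotone LP separator, or does it need `t^{2+Ω(1)}`?  Every natural separator
(odd closed walks as flows, level-3 Sherali–Adams, metric-polytope certificates) carries one variable per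
transversal triangle (`t³`).  Numerics for `t = 4,5,6` ride as kit evidence on the item (lead c5).

Defined here (file-local): `TriangleInst.TriZ`, `TriangleInst.triM`, `TriangleInst.sgnR`.
No facts are cited as hypotheses; everything is elementary.
-/

set_option linter.dupNamespace false -- `Summit.PneNP.PneNP.…`: summit = sub-problem (D-0017)

namespace Summit.PneNP.PneNP.Theorems.XorDoor

open scoped BigOperators
open Finset Matrix

noncomputable section

namespace TriangleInst

variable {t : ℕ}

/-! ## §1 The instance -/

/-- The word set of the triangle instance: the two constant words of `𝔽₂³` (all three looked-up bits
agree = all three 2-XOR constraints of the odd triangle violated). -/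
def TriZ : Set (Fin 3 → ZMod 2) := {z | z 0 = z 1 ∧ z 1 = z 2}

/-- The triangle matrix `M_t[x,w] = 1 + 2·[x₀(w₀) = x₁(w₁) = x₂(w₂)] ∈ {1, 3}`: the number of violated
constraints of the odd triangle `y₀ ≠ y₁, y₁ ≠ y₂, y₂ ≠ y₀` at the looked-up word `y = x[w]`. -/
def triM (t : ℕ) (x : Fin 3 → Fin t → ZMod 2) (w : Fin 3 → Fin t) : ℝ :=
  if x 0 (w 0) = x 1 (w 1) ∧ x 1 (w 1) = x 2 (w 2) then 3 else 1

/-- `M_t` as the sum of the three pair-agreement indicators `[y_i = y_{i+1}]` (indices mod 3). -/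
theorem triM_eq_sum_pairs (x : Fin 3 → Fin t → ZMod 2) (w : Fin 3 → Fin t) :
    triM t x w = ∑ i : Fin 3, if x i (w i) = x (i + 1) (w (i + 1)) then (1 : ℝ) else 0 := by
  simp only [triM, Fin.sum_univ_three]
  have h3 : ((2 : Fin 3) + 1) = 0 := by decide
  simp only [show ((0 : Fin 3) + 1) = 1 from rfl, show ((1 : Fin 3) + 1) = 2 from rfl, h3]
  rcases IndexRect.zmod2_cases (x 0 (w 0)) with h0 | h0 <;>
  rcases IndexRect.zmod2_cases (x 1 (w 1)) with h1 | h1 <;>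
  rcases IndexRect.zmod2_cases (x 2 (w 2)) with h2 | h2 <;>
  simp [h0, h1, h2] <;> norm_num

/-- The looked-up word is constant iff the three looked-up bits agree. -/
theorem lookup_mem_TriZ_iff (x : Fin 3 → Fin t → ZMod 2) (w : Fin 3 → Fin t) :
    IndexRect.lookup x w ∈ TriZ ↔ (x 0 (w 0) = x 1 (w 1) ∧ x 1 (w 1) = x 2 (w 2)) := Iff.rfl

/-- `M_t − 1 = 2·[x[w] ∈ TriZ]`. -/
theorem triM_sub_one (x : Fin 3 → Fin t → ZMod 2) (w : Fin 3 → Fin t) :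
    triM t x w - 1 = if (x 0 (w 0) = x 1 (w 1) ∧ x 1 (w 1) = x 2 (w 2)) then (2 : ℝ) else 0 := by
  simp only [triM]
  split_ifs <;> norm_num

/-- `M_t ≥ 1`. -/
theorem one_le_triM (x : Fin 3 → Fin t → ZMod 2) (w : Fin 3 → Fin t) : 1 ≤ triM t x w := by
  simp only [triM]
  split_ifs <;> norm_num

/-! ## §2 The cheap corner and the unit level, upper bounds -/

/-- **Cheap corner.** `M_t` has a purely non-negative factorisation with `3t²` rank-one 0/1 terms:
one rectangle `[x_i(π) = x_{i+1}(ρ)] · [w_i = π, w_{i+1} = ρ]` per pair `i` and pointer pair `(π, ρ)`. -/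
theorem coneFact_triM (t : ℕ) : HasConeFact (triM t) 0 (3 * t ^ 2) := by
  have hcard : Fintype.card (Fin 3 × Fin t × Fin t) = 3 * t ^ 2 := by
    simp only [Fintype.card_prod, Fintype.card_fin]; ring
  obtain ⟨σ⟩ : Nonempty ((Fin 3 × Fin t × Fin t) ≃ Fin (3 * t ^ 2)) := ⟨Fintype.equivFinOfCardEq hcard⟩
  set A : (Fin 3 → Fin t → ZMod 2) → (Fin 3 × Fin t × Fin t) → ℝ := fun x c =>
    if x c.1 c.2.1 = x (c.1 + 1) c.2.2 then 1 else 0 with hA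
  set B : (Fin 3 × Fin t × Fin t) → (Fin 3 → Fin t) → ℝ := fun c w =>
    if (w c.1, w (c.1 + 1)) = c.2 then 1 else 0 with hB
  refine ⟨fun _ => 0, fun _ => 0, fun x l => A x (σ.symm l), fun l w => B (σ.symm l) w,
    fun _ => Matrix.PosSemidef.zero, fun _ => Matrix.PosSemidef.zero, ?_, ?_, ?_⟩
  · intro x l; simp only [hA]; split_ifs <;> norm_num
  · intro l w; simp only [hB]; split_ifs <;> norm_num
  intro x w
  show triM t x w = ((0 : Matrix (Fin 0) (Fin 0) ℝ) * 0).trace + ∑ l, A x (σ.symm l) * B (σ.symm l) w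
  have htr : ((0 : Matrix (Fin 0) (Fin 0) ℝ) * 0).trace = 0 := by simp
  rw [htr, zero_add]
  rw [show (∑ l, A x (σ.symm l) * B (σ.symm l) w) = ∑ c : Fin 3 × Fin t × Fin t, A x c * B c w from
    Fintype.sum_equiv σ.symm _ _ (fun _ => rfl)]
  rw [triM_eq_sum_pairs, Fintype.sum_prod_type]
  refine Finset.sum_congr rfl fun i _ => ?_
  simp only [hB, mul_boole]
  rw [Finset.sum_ite_eq]
  simp only [Finset.mem_univ, if_true, hA]

/-- **Unit level, upper side.** `M_t − J = 2·[x[w] ∈ TriZ]` has a purely non-negative factorisation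
with `t³` terms: one rectangle `2·[x[w'] ∈ TriZ] · [w = w']` per pointer triple `w'`. -/
theorem coneFact_triM_sub_one (t : ℕ) : HasConeFact (fun x w => triM t x w - 1) 0 (t ^ 3) := by
  have hcard : Fintype.card (Fin 3 → Fin t) = t ^ 3 := by
    simp only [Fintype.card_fun, Fintype.card_fin]
  obtain ⟨σ⟩ : Nonempty ((Fin 3 → Fin t) ≃ Fin (t ^ 3)) := ⟨Fintype.equivFinOfCardEq hcard⟩
  classical
  set A : (Fin 3 → Fin t → ZMod 2) → (Fin 3 → Fin t) → ℝ := fun x w' => triM t x w' - 1 with hA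
  set B : (Fin 3 → Fin t) → (Fin 3 → Fin t) → ℝ := fun w' w => if w = w' then 1 else 0 with hB
  refine ⟨fun _ => 0, fun _ => 0, fun x l => A x (σ.symm l), fun l w => B (σ.symm l) w,
    fun _ => Matrix.PosSemidef.zero, fun _ => Matrix.PosSemidef.zero, ?_, ?_, ?_⟩
  · intro x l; simp only [hA]; linarith [one_le_triM x (σ.symm l)]
  · intro l w; simp only [hB]; split_ifs <;> norm_num
  intro x w
  show triM t x w - 1 = ((0 : Matrix (Fin 0) (Fin 0) ℝ) * 0).trace + ∑ l, A x (σ.symm l) * B (σ.symm l) w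
  have htr : ((0 : Matrix (Fin 0) (Fin 0) ℝ) * 0).trace = 0 := by simp
  rw [htr, zero_add]
  rw [show (∑ l, A x (σ.symm l) * B (σ.symm l) w) = ∑ c : Fin 3 → Fin t, A x c * B c w from
    Fintype.sum_equiv σ.symm _ _ (fun _ => rfl)]
  simp only [hB, mul_boole]
  rw [Finset.sum_ite_eq]
  simp only [Finset.mem_univ, if_true, hA]

/-! ## §3 The unit level, lower bound: exponent exactly `3` -/

/-- `TriZ` (two antipodal points of the 3-cube) contains no subcube of codimension `< 3`: any two
prescribed coordinates extend to a non-constant word. -/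
theorem tri_noSubcube : IndexRect.NoSubcube TriZ 3 := by
  intro S hS z₀
  -- a free coordinate
  have hne : S ≠ Finset.univ := by
    intro h; rw [h, Finset.card_univ, Fintype.card_fin] at hS; exact lt_irrefl _ hS
  obtain ⟨i, -, hi⟩ : ∃ i ∈ (Finset.univ : Finset (Fin 3)), i ∉ S := by
    by_contra h
    push Not at h
    exact hne (Finset.eq_univ_of_forall fun j => h j (Finset.mem_univ j))
  -- another coordinate `j ≠ i`, and the word equal to `z₀` off `i` and to `z₀ j + 1` at `i`
  let j : Fin 3 := i + 1
  have hji : j ≠ i := by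
    intro h
    have : (i + 1) - i = i - i := by rw [show i + 1 = j from rfl, h]
    simp at this
  refine ⟨Function.update z₀ i (z₀ j + 1), fun k hk => ?_, ?_⟩
  · have hki : k ≠ i := fun h => hi (h ▸ hk)
    simp [Function.update_of_ne hki]
  · intro hmem
    simp only [TriZ, Set.mem_setOf_eq] at hmem
    -- in a constant word all coordinates agree, in particular `i` and `j`
    have hconst : ∀ a b : Fin 3, Function.update z₀ i (z₀ j + 1) a = Function.update z₀ i (z₀ j + 1) b := by
      intro a b
      have h01 := hmem.1; have h12 := hmem.2
      have hall : ∀ c : Fin 3, Function.update z₀ i (z₀ j + 1) c = Function.update z₀ i (z₀ j + 1) 0 := by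
        intro c; fin_cases c
        · rfl
        · exact h01.symm
        · exact h12.symm.trans h01.symm
      rw [hall a, hall b]
    have h := hconst i j
    rw [Function.update_self, Function.update_of_ne hji] at h
    -- `z₀ j + 1 = z₀ j` is impossible in `𝔽₂`
    have : (1 : ZMod 2) = 0 := by
      have := congrArg (fun u => u - z₀ j) h
      simp at this
    exact absurd this (by decide)

/-- The finite set of constant words has exactly two elements. -/
theorem card_TriZ :
    (univ.filter fun z : Fin 3 → ZMod 2 => z 0 = z 1 ∧ z 1 = z 2).card = 2 := by
  decide

/-- **Unit level, lower side (exact exponent `3`).** For every `t ≥ 1`, every non-negative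
factorisation `M_t[x,w] − 1 = ∑_{l<r} U_{x,l} V_{l,w}` has `t³ ≤ 108·r`: the support of `M_t − J` is the
lift of `TriZ` (`t³ · 2 · 2^{3(t−1)}` entries) and each of the `r` support rectangles obeys the
Index-lift rectangle lemma with `κ = 3` (`#X·#W·t³ ≤ 27·t³·2^{3t}`). With `coneFact_triM_sub_one`:
`rk₊(M_t − J) = Θ(t³)`, against `rk₊(M_t) ≤ 3t²`. -/
theorem triM_unitLevel {r : ℕ} (ht : 1 ≤ t)
    (U : (Fin 3 → Fin t → ZMod 2) → Fin r → ℝ) (V : Fin r → (Fin 3 → Fin t) → ℝ)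
    (hU : ∀ x l, 0 ≤ U x l) (hV : ∀ l w, 0 ≤ V l w)
    (hM : ∀ (x : Fin 3 → Fin t → ZMod 2) (w : Fin 3 → Fin t), triM t x w - 1 = ∑ l, U x l * V l w) :
    t ^ 3 ≤ 108 * r := by
  classical
  obtain ⟨s, rfl⟩ : ∃ s, t = s + 1 := ⟨t - 1, by omega⟩
  set Zs : Finset (Fin 3 → ZMod 2) := univ.filter fun z : Fin 3 → ZMod 2 => z 0 = z 1 ∧ z 1 = z 2 with hZs
  let M : (Fin 3 → Fin (s + 1) → ZMod 2) → (Fin 3 → Fin (s + 1)) → ℝ := fun x w => triM (s + 1) x w - 1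
  have hMdef : ∀ x w, M x w = ∑ l, U x l * V l w := fun x w => hM x w
  have hsupp : ∀ x w, M x w ≠ 0 → IndexRect.lookup x w ∈ TriZ := by
    intro x w hne
    rw [lookup_mem_TriZ_iff]
    by_contra hno
    apply hne
    show triM (s + 1) x w - 1 = 0
    rw [triM_sub_one, if_neg hno]
  let P : Finset ((Fin 3 → Fin (s + 1) → ZMod 2) × (Fin 3 → Fin (s + 1))) :=
    univ.filter fun p => IndexRect.lookup p.1 p.2 ∈ Zs
  have hP : ∀ p ∈ P, 0 < M p.1 p.2 := by
    intro p hp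
    simp only [P, hZs, mem_filter, mem_univ, true_and] at hp
    show 0 < triM (s + 1) p.1 p.2 - 1
    have hp' : p.1 0 (p.2 0) = p.1 1 (p.2 1) ∧ p.1 1 (p.2 1) = p.1 2 (p.2 2) := hp
    rw [triM_sub_one, if_pos hp']; norm_num
  have hmain := IndexRect.indexRect_nmf_bound _ tri_noSubcube M hsupp U V hU hV hMdef P hP
  have hPcard : P.card = (s + 1) ^ 3 * (Zs.card * (2 ^ s) ^ 3) := by
    simpa using UnitLevel.card_lift (m := 3) (t := s + 1) Zs
  have hZcard : Zs.card = 2 := card_TriZ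
  rw [hPcard, hZcard] at hmain
  have hpow : (2 : ℕ) ^ (3 * (s + 1)) = 8 * (2 ^ s) ^ 3 := by
    rw [show 3 * (s + 1) = s * 3 + 3 by ring, pow_add, pow_mul]; norm_num; ring
  rw [hpow] at hmain
  -- cancel the common factor `(s+1)^3 · (2^s)^3 · 2`
  have hc : 0 < (s + 1) ^ 3 * (2 ^ s) ^ 3 * 2 := by positivity
  refine Nat.le_of_mul_le_mul_right ?_ hc
  calc (s + 1) ^ 3 * ((s + 1) ^ 3 * (2 ^ s) ^ 3 * 2)
      = (s + 1) ^ 3 * (2 * (2 ^ s) ^ 3) * (s + 1) ^ 3 := by ring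
    _ ≤ r * (3 ^ 3 * ((s + 1) ^ 3 * (8 * (2 ^ s) ^ 3))) := hmain
    _ = 108 * r * ((s + 1) ^ 3 * (2 ^ s) ^ 3 * 2) := by ring

/-! ## §4 The mixed cone does not see the instance: a PSD factorisation of size `3t + 1` for every
`ε ≤ 3/4` -/

/-- The real sign `(−1)^b` of a bit. -/
def sgnR (b : ZMod 2) : ℝ := if b = 0 then 1 else -1

/-- The degree-1 SOS identity behind the instance: with `s_i = (−1)^{y_i}`,
`1 + 2[y₀ = y₁ = y₂] = 3/4 + (s₀ + s₁ + s₂)²/4`. -/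
theorem triM_eq_sos (x : Fin 3 → Fin t → ZMod 2) (w : Fin 3 → Fin t) :
    triM t x w = 3 / 4 + (sgnR (x 0 (w 0)) + sgnR (x 1 (w 1)) + sgnR (x 2 (w 2))) ^ 2 / 4 := by
  simp only [triM, sgnR]
  rcases IndexRect.zmod2_cases (x 0 (w 0)) with h0 | h0 <;>
  rcases IndexRect.zmod2_cases (x 1 (w 1)) with h1 | h1 <;>
  rcases IndexRect.zmod2_cases (x 2 (w 2)) with h2 | h2 <;>
  simp [h0, h1, h2] <;> norm_num

/-- **The PSD part is cheap at every `ε ≤ 3/4`.** For `0 ≤ ε ≤ 3/4` the shifted triangle matrix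
`M_t − ε` has a `(PSD_{3t+1} ⊕ ℝ^0)`-factorisation: `H_x = c·e₀e₀ᵀ + φ(x)φ(x)ᵀ/4`,
`Y_w = e₀e₀ᵀ + ψ(w)ψ(w)ᵀ` with `c = 3/4 − ε`, `φ(x)_{(i,π)} = (−1)^{x_i(π)}`, `ψ(w)_{(i,π)} = [w_i = π]`,
so that `tr(H_x Y_w) = c + (s₀+s₁+s₂)²/4 = M_t[x,w] − ε` (`triM_eq_sos`). Hence in the currency
`q + r` of `stub_exactLifting` the triangle instance has strict size `O(t)`: it probes the LP
mechanism only. -/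
theorem coneFact_triM_shift_psd (t : ℕ) {ε : ℝ} (hε : ε ≤ 3 / 4) :
    HasConeFact (fun x w => triM t x w - ε) (3 * t + 1) 0 := by
  classical
  -- index set `Option (Fin 3 × Fin t)` of size `3t + 1`
  have hcard : Fintype.card (Option (Fin 3 × Fin t)) = 3 * t + 1 := by
    simp only [Fintype.card_option, Fintype.card_prod, Fintype.card_fin]
  obtain ⟨σ⟩ : Nonempty (Option (Fin 3 × Fin t) ≃ Fin (3 * t + 1)) := ⟨Fintype.equivFinOfCardEq hcard⟩
  set c : ℝ := 3 / 4 - ε with hc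
  have hcnn : 0 ≤ c := by rw [hc]; linarith
  -- the four vectors on `Option (Fin 3 × Fin t)`, transported to `Fin (3t+1)`
  let h₁ : (Fin 3 → Fin t → ZMod 2) → Option (Fin 3 × Fin t) → ℝ := fun _ o =>
    Option.casesOn o (Real.sqrt c) (fun _ => 0)
  let h₂ : (Fin 3 → Fin t → ZMod 2) → Option (Fin 3 × Fin t) → ℝ := fun x o =>
    Option.casesOn o 0 (fun ip => sgnR (x ip.1 ip.2) / 2)
  let y₁ : (Fin 3 → Fin t) → Option (Fin 3 × Fin t) → ℝ := fun _ o => Option.casesOn o 1 (fun _ => 0)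
  let y₂ : (Fin 3 → Fin t) → Option (Fin 3 × Fin t) → ℝ := fun w o =>
    Option.casesOn o 0 (fun ip => if w ip.1 = ip.2 then 1 else 0)
  let a₁ : (Fin 3 → Fin t → ZMod 2) → Fin (3 * t + 1) → ℝ := fun x l => h₁ x (σ.symm l)
  let a₂ : (Fin 3 → Fin t → ZMod 2) → Fin (3 * t + 1) → ℝ := fun x l => h₂ x (σ.symm l)
  let u₁ : (Fin 3 → Fin t) → Fin (3 * t + 1) → ℝ := fun w l => y₁ w (σ.symm l)
  let u₂ : (Fin 3 → Fin t) → Fin (3 * t + 1) → ℝ := fun w l => y₂ w (σ.symm l)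
  let H : (Fin 3 → Fin t → ZMod 2) → Matrix (Fin (3 * t + 1)) (Fin (3 * t + 1)) ℝ := fun x =>
    vecMulVec (a₁ x) (a₁ x) + vecMulVec (a₂ x) (a₂ x)
  let Y : (Fin 3 → Fin t) → Matrix (Fin (3 * t + 1)) (Fin (3 * t + 1)) ℝ := fun w =>
    vecMulVec (u₁ w) (u₁ w) + vecMulVec (u₂ w) (u₂ w)
  -- the four inner products
  have hdot : ∀ (f : (Fin 3 → Fin t → ZMod 2) → Option (Fin 3 × Fin t) → ℝ)
      (g : (Fin 3 → Fin t) → Option (Fin 3 × Fin t) → ℝ) (x : Fin 3 → Fin t → ZMod 2) (w : Fin 3 → Fin t),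
      (fun l => f x (σ.symm l)) ⬝ᵥ (fun l => g w (σ.symm l)) = ∑ o : Option (Fin 3 × Fin t), f x o * g w o := by
    intro f g x w
    rw [dotProduct]
    exact Fintype.sum_equiv σ.symm _ _ (fun _ => rfl)
  have h11 : ∀ x w, a₁ x ⬝ᵥ u₁ w = Real.sqrt c := by
    intro x w
    show (fun l => h₁ x (σ.symm l)) ⬝ᵥ (fun l => y₁ w (σ.symm l)) = Real.sqrt c
    rw [hdot, Fintype.sum_option]
    simp [h₁, y₁]
  have h12 : ∀ x w, a₁ x ⬝ᵥ u₂ w = 0 := by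
    intro x w
    show (fun l => h₁ x (σ.symm l)) ⬝ᵥ (fun l => y₂ w (σ.symm l)) = 0
    rw [hdot, Fintype.sum_option]
    simp [h₁, y₂]
  have h21 : ∀ x w, a₂ x ⬝ᵥ u₁ w = 0 := by
    intro x w
    show (fun l => h₂ x (σ.symm l)) ⬝ᵥ (fun l => y₁ w (σ.symm l)) = 0
    rw [hdot, Fintype.sum_option]
    simp [h₂, y₁]
  have h22 : ∀ x w, a₂ x ⬝ᵥ u₂ w = (sgnR (x 0 (w 0)) + sgnR (x 1 (w 1)) + sgnR (x 2 (w 2))) / 2 := by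
    intro x w
    show (fun l => h₂ x (σ.symm l)) ⬝ᵥ (fun l => y₂ w (σ.symm l)) = _
    rw [hdot, Fintype.sum_option]
    simp only [h₂, y₂, zero_add, mul_ite, mul_one, mul_zero]
    rw [Fintype.sum_prod_type]
    simp only [Finset.sum_ite_eq, Finset.mem_univ, if_true, Fin.sum_univ_three]
    ring
  refine ⟨H, Y, (fun _ => Fin.elim0), (fun l => Fin.elim0 l), fun x => ?_, fun w => ?_,
    fun _ l => Fin.elim0 l, fun l => Fin.elim0 l, fun x w => ?_⟩
  · exact (by simpa using posSemidef_vecMulVec_self_star (a₁ x) :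
        (vecMulVec (a₁ x) (a₁ x)).PosSemidef).add
      (by simpa using posSemidef_vecMulVec_self_star (a₂ x))
  · exact (by simpa using posSemidef_vecMulVec_self_star (u₁ w) :
        (vecMulVec (u₁ w) (u₁ w)).PosSemidef).add
      (by simpa using posSemidef_vecMulVec_self_star (u₂ w))
  · show triM t x w - ε = (H x * Y w).trace + ∑ l : Fin 0, Fin.elim0 l * Fin.elim0 l
    simp only [Finset.univ_eq_empty, Finset.sum_empty, add_zero, H, Y, Matrix.add_mul, Matrix.mul_add,
      Matrix.trace_add, trace_vecMulVec_mul_vecMulVec, h11, h12, h21, h22]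
    rw [Real.sq_sqrt hcnn, triM_eq_sos, hc]
    ring

end TriangleInst

/-- **Registered sub-goal `triangle_window` of stmt-PneNP-10680** (by name): the kernel-checked window
of the TRIANGLE instance `M_t[x,w] = 1 + 2·[x₀(w₀) = x₁(w₁) = x₂(w₂)]` of `stub_exactLifting`'s
mechanism, for every `t ≥ 1`: (i) `rk₊(M_t) ≤ 3t²` (cheap corner); (ii) `rk₊(M_t − J) ≤ t³` and
(iii) every non-negative factorisation of `M_t − J` with `r` terms has `t³ ≤ 108·r` (unit level, exact
exponent `3`); (iv) for `0 ≤ ε ≤ 3/4` the shift `M_t − ε` has a `(PSD_{3t+1} ⊕ ℝ^0)`-factorisation (the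
mixed cone is blind to the instance; `ε < 0` is allowed and trivial). The LP strict rank of `M_t` in
`[3t² − 3t + 1, t³ + 1]` is the open question of record. -/
theorem triangle_window : ∀ t : ℕ, 1 ≤ t →
    HasConeFact (TriangleInst.triM t) 0 (3 * t ^ 2) ∧
    HasConeFact (fun x w => TriangleInst.triM t x w - 1) 0 (t ^ 3) ∧
    (∀ (r : ℕ) (U : (Fin 3 → Fin t → ZMod 2) → Fin r → ℝ) (V : Fin r → (Fin 3 → Fin t) → ℝ),
      (∀ x l, 0 ≤ U x l) → (∀ l w, 0 ≤ V l w) →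
      (∀ (x : Fin 3 → Fin t → ZMod 2) (w : Fin 3 → Fin t), TriangleInst.triM t x w - 1 = ∑ l, U x l * V l w) →
      t ^ 3 ≤ 108 * r) ∧
    (∀ ε : ℝ, ε ≤ 3 / 4 → HasConeFact (fun x w => TriangleInst.triM t x w - ε) (3 * t + 1) 0) :=
  fun t ht => ⟨TriangleInst.coneFact_triM t, TriangleInst.coneFact_triM_sub_one t,
    fun _ U V hU hV hM => TriangleInst.triM_unitLevel ht U V hU hV hM,
    fun _ hε => TriangleInst.coneFact_triM_shift_psd t hε⟩

end

end Summit.PneNP.PneNP.Theorems.XorDoor
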